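import Summits.ResolutionOfSingularities.ResolutionOfSingularities.Theorems.FrobeniusLadderFInjectiveMacaulayficationTwoRatioBPChart5NotFull
import HarnessLib

/-!
# ROW #13 / BED CI-3 — the four Rees charts `D₊(x̄₂t), …, D₊(x̄₅t)` of `Bl_𝔪 X`, `X = V(x₀²+x₁³+x₂⁵+x₃⁵+x₄⁷+x₅⁷, x₀²+2x₁³+x₂¹⁰+x₃¹⁰+x₄¹⁴+x₅¹⁴)`, are COHEN–MACAULAY at every prime
# (crux `FInjectiveMacaulayfication` stmt-ResolutionOfSingularities-15315, chain w45a; res-L1-w45a-plan-1 RULING R24.2 (b) «(α′) GO — ROW #13 TWO-SIDED … floor LEGAL (✓`TowerBedChartCM.cmCl_reesChart`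
# with the per-chart specs)»; seat res-L1-w45a-stub-2 g13; the CI-3 twin of ✓`DiagonalBPCIChartsCM`)

[OURS · L1 W4.5a] Support file (`--supports stmt-ResolutionOfSingularities-15315 --as helper`); def-free; UNCONDITIONAL; no named fact, no sorry; a census certificate on ONE bed; NOT a
statement of any manuscript. AI-written (AI review weaker than expert review).

On the chart `xⱼ ≠ 0` (`j = 2, …, 5`) the strict transforms of `P = 2F₀ − F₁ = x₀² − G`, `Q = F₁ − F₀ = x₁³ + H` are `θⱼP = yⱼ²(y₀² − ιGⱼ)`, `θⱼQ = yⱼ³(y₁³ + ιHⱼ)` with `Gⱼ, Hⱼ ∈ k[y₂..y₅]`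
(`Gⱼ(0) = 0`, `Hⱼ(0) = 0`); `Gⱼ` is not a square (`2 ≠ 0`: `yⱼ ↦ t` gives `(t^{aⱼ} − 2)t^{aⱼ−2}`, odd TRAILING degree `3` resp. `5`) and `−Hⱼ` is not a cube (`t^{2aⱼ−3} − t^{aⱼ−3}`, degree `7`
resp. `11`), so ✓`TowerBedChartCM.cmCl_reesChart` applies: `D₊(x̄ⱼt) ≅ Spec k[y]/(yⱼ-tower)` is CM at every prime.
* §1 two spec-shape lemmas (`no_square_of_spec_shape`, `no_cube_of_spec_shape`); §2–§5 the charts `x₂, x₃, x₄, x₅` (`theta_P_*`, `theta_Q_*`, `no_square_G_*`, `no_cube_H_*`,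
  `cmCl_reesChart_*`; for the chart `x₅` the specs are ✓`TwoRatioBPChart5NotFull.no_square_G₅` / `no_cube_H₅`).
[cite: Matsumura1987, Thm. 17.4 (iii)] [cite: StacksProject, Tag 0804] [cite: GortzWedhorn2020, Prop. 13.91]
-/

-- single-problem summit: the doubled namespace component is forced
set_option linter.dupNamespace false

noncomputable section

open AlgebraicGeometry MvPolynomial IsLocalRing

namespace Summit.ResolutionOfSingularities.ResolutionOfSingularities.Theorems.FInjectiveMacaulayfication.TwoRatioBPChartsCM

open Summit.ResolutionOfSingularities.ResolutionOfSingularities.Theorems.FInjectiveMacaulayfication SliceableCentre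
open Literature.AlgebraicGeometry.Resolution

variable (k : Type) [Field k]

/-! ## §1 Spec shapes -/

/-- **No square by a trailing-degree spec shape**: if `s G = (t^e − 2)·t^m` with `m` odd and `2 ≠ 0`, then `y² ≠ G` for all `y`. [elementary] -/
theorem no_square_of_spec_shape (h2 : (2 : k) ≠ 0) (G : MvPolynomial (Fin 4) k) (s : MvPolynomial (Fin 4) k →+* Polynomial k) (e m : ℕ) (he : 0 < e)
    (hm : ¬ 2 ∣ m) (hs : s G = (Polynomial.X ^ e - Polynomial.C 2) * Polynomial.X ^ m) (y : MvPolynomial (Fin 4) k) : y ^ 2 ≠ G := by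
  have hc0 : Polynomial.constantCoeff (Polynomial.X ^ e - Polynomial.C (2 : k)) = -2 := by
    have hne : (0 : ℕ) ≠ e := fun h => he.ne' h.symm
    simp [hne]
  have hc : (Polynomial.X ^ e - Polynomial.C (2 : k)) ≠ 0 := fun h => by
    rw [h, map_zero] at hc0
    exact h2 (neg_eq_zero.mp hc0.symm)
  refine TwoRatioBPChart5NotFull.no_square_of_spec_trailing k G s _ hs (mul_ne_zero hc (pow_ne_zero _ Polynomial.X_ne_zero)) m ?_ hm y
  rw [Polynomial.natTrailingDegree_mul_X_pow hc m, Polynomial.natTrailingDegree_eq_zero_of_constantCoeff_ne_zero, zero_add]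
  rw [hc0]
  exact neg_ne_zero.mpr h2

/-- **No cube by a degree spec shape**: if `s H = t^e − t^m` with `m < e` and `3 ∤ e`, then `y³ + H ≠ 0` for all `y`. [elementary] -/
theorem no_cube_of_spec_shape (H : MvPolynomial (Fin 4) k) (s : MvPolynomial (Fin 4) k →+* Polynomial k) (e m : ℕ) (hme : m < e) (he : ¬ 3 ∣ e)
    (hs : s H = Polynomial.X ^ e - Polynomial.X ^ m) (y : MvPolynomial (Fin 4) k) : y ^ 3 + H ≠ 0 := by
  refine DiagonalBPCIChartsCM.no_cube_of_spec k H s _ hs e ?_ he y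
  rw [Polynomial.natDegree_sub_eq_left_of_natDegree_lt] <;> simp [hme]

section Bed

variable (F : Fin 2 → MvPolynomial (Fin 6) k)
  (hF0 : F 0 = X 0 ^ 2 + X 1 ^ 3 + X 2 ^ 5 + X 3 ^ 5 + X 4 ^ 7 + X 5 ^ 7)
  (hF1 : F 1 = X 0 ^ 2 + C 2 * X 1 ^ 3 + X 2 ^ 10 + X 3 ^ 10 + X 4 ^ 14 + X 5 ^ 14)
include hF0 hF1

/-! ## §2 Chart `x₂` -/

set_option linter.unusedSimpArgs false in
-- one `simp only` set serves all chart identities of this file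
/-- `θ₂P = y₂²·(y₀² − ιG₂)`. [folklore] -/
theorem theta_P_two : aeval (fun i : Fin 6 => if i = 2 then (X 2 : MvPolynomial (Fin 6) k) else X i * X 2) (C 2 * F 0 - F 1) =
    X 2 ^ 2 * ((![(X 0 : MvPolynomial (Fin 6) k) ^ 2 - MvPolynomial.eval₂Hom MvPolynomial.C ![MvPolynomial.X 2, MvPolynomial.X 3, MvPolynomial.X 4, MvPolynomial.X 5]
      (X 1 ^ 10 * X 0 ^ 8 - C 2 * (X 1 ^ 5 * X 0 ^ 3) + X 2 ^ 14 * X 0 ^ 12 - C 2 * (X 2 ^ 7 * X 0 ^ 5) + X 3 ^ 14 * X 0 ^ 12 - C 2 * (X 3 ^ 7 * X 0 ^ 5) + X 0 ^ 8 - C 2 * X 0 ^ 3 : MvPolynomial (Fin 4) k),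
      (X 1 : MvPolynomial (Fin 6) k) ^ 3 + MvPolynomial.eval₂Hom MvPolynomial.C ![MvPolynomial.X 2, MvPolynomial.X 3, MvPolynomial.X 4, MvPolynomial.X 5]
      (X 1 ^ 10 * X 0 ^ 7 - X 1 ^ 5 * X 0 ^ 2 + X 2 ^ 14 * X 0 ^ 11 - X 2 ^ 7 * X 0 ^ 4 + X 3 ^ 14 * X 0 ^ 11 - X 3 ^ 7 * X 0 ^ 4 + X 0 ^ 7 - X 0 ^ 2 : MvPolynomial (Fin 4) k)] : Fin 2 → MvPolynomial (Fin 6) k) 0) := by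
  rw [hF0, hF1]
  simp only [Matrix.cons_val_zero, map_sub, map_add, map_mul, map_pow, aeval_X, aeval_C, algebraMap_eq, Fin.reduceEq, if_true, if_false, map_ofNat, reduceIte,
    MvPolynomial.eval₂Hom_X', MvPolynomial.eval₂Hom_C, Matrix.cons_val_one, Matrix.cons_val]
  ring

set_option linter.unusedSimpArgs false in
-- one `simp only` set serves all chart identities of this file
/-- `θ₂Q = y₂³·(y₁³ + ιH₂)`. [folklore] -/
theorem theta_Q_two : aeval (fun i : Fin 6 => if i = 2 then (X 2 : MvPolynomial (Fin 6) k) else X i * X 2) (F 1 - F 0) =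
    X 2 ^ 3 * ((![(X 0 : MvPolynomial (Fin 6) k) ^ 2 - MvPolynomial.eval₂Hom MvPolynomial.C ![MvPolynomial.X 2, MvPolynomial.X 3, MvPolynomial.X 4, MvPolynomial.X 5]
      (X 1 ^ 10 * X 0 ^ 8 - C 2 * (X 1 ^ 5 * X 0 ^ 3) + X 2 ^ 14 * X 0 ^ 12 - C 2 * (X 2 ^ 7 * X 0 ^ 5) + X 3 ^ 14 * X 0 ^ 12 - C 2 * (X 3 ^ 7 * X 0 ^ 5) + X 0 ^ 8 - C 2 * X 0 ^ 3 : MvPolynomial (Fin 4) k),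
      (X 1 : MvPolynomial (Fin 6) k) ^ 3 + MvPolynomial.eval₂Hom MvPolynomial.C ![MvPolynomial.X 2, MvPolynomial.X 3, MvPolynomial.X 4, MvPolynomial.X 5]
      (X 1 ^ 10 * X 0 ^ 7 - X 1 ^ 5 * X 0 ^ 2 + X 2 ^ 14 * X 0 ^ 11 - X 2 ^ 7 * X 0 ^ 4 + X 3 ^ 14 * X 0 ^ 11 - X 3 ^ 7 * X 0 ^ 4 + X 0 ^ 7 - X 0 ^ 2 : MvPolynomial (Fin 4) k)] : Fin 2 → MvPolynomial (Fin 6) k) 1) := by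
  rw [hF0, hF1]
  simp only [Matrix.cons_val_zero, map_sub, map_add, map_mul, map_pow, aeval_X, aeval_C, algebraMap_eq, Fin.reduceEq, if_true, if_false, map_ofNat, reduceIte,
    MvPolynomial.eval₂Hom_X', MvPolynomial.eval₂Hom_C, Matrix.cons_val_one, Matrix.cons_val]
  ring

omit hF0 hF1 in
set_option linter.unusedSimpArgs false in
-- shared `simp only` set for the specialisations
/-- `G₂` is not a square (`2 ≠ 0`; `y₂ ↦ t` gives `(t⁵ − 2)·t³`). [elementary] -/
theorem no_square_G_two (h2 : (2 : k) ≠ 0) (y : MvPolynomial (Fin 4) k) : y ^ 2 ≠ (X 1 ^ 10 * X 0 ^ 8 - C 2 * (X 1 ^ 5 * X 0 ^ 3) + X 2 ^ 14 * X 0 ^ 12 - C 2 * (X 2 ^ 7 * X 0 ^ 5) + X 3 ^ 14 * X 0 ^ 12 - C 2 * (X 3 ^ 7 * X 0 ^ 5) + X 0 ^ 8 - C 2 * X 0 ^ 3 : MvPolynomial (Fin 4) k) := by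
  refine no_square_of_spec_shape k h2 _ (MvPolynomial.eval₂Hom (Polynomial.C : k →+* Polynomial k) (![Polynomial.X, 0, 0, 0] : Fin 4 → Polynomial k)) 5 3 (by norm_num)
    (by norm_num) ?_ y
  simp only [map_add, map_sub, map_mul, map_pow, MvPolynomial.eval₂Hom_X', MvPolynomial.eval₂Hom_C, Matrix.cons_val_zero, Matrix.cons_val_one, Matrix.cons_val]
  ring

omit hF0 hF1 in
set_option linter.unusedSimpArgs false in
-- shared `simp only` set for the specialisations
/-- `−H₂` is not a cube (`y₂ ↦ t` gives `t⁷ − t²`). [elementary] -/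
theorem no_cube_H_two (y : MvPolynomial (Fin 4) k) : y ^ 3 + (X 1 ^ 10 * X 0 ^ 7 - X 1 ^ 5 * X 0 ^ 2 + X 2 ^ 14 * X 0 ^ 11 - X 2 ^ 7 * X 0 ^ 4 + X 3 ^ 14 * X 0 ^ 11 - X 3 ^ 7 * X 0 ^ 4 + X 0 ^ 7 - X 0 ^ 2 : MvPolynomial (Fin 4) k) ≠ 0 := by
  refine no_cube_of_spec_shape k _ (MvPolynomial.eval₂Hom (Polynomial.C : k →+* Polynomial k) (![Polynomial.X, 0, 0, 0] : Fin 4 → Polynomial k)) 7 2 (by norm_num)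
    (by norm_num) ?_ y
  simp only [map_add, map_sub, map_mul, map_pow, MvPolynomial.eval₂Hom_X', MvPolynomial.eval₂Hom_C, Matrix.cons_val_zero, Matrix.cons_val_one, Matrix.cons_val]
  ring

/-- ★ **The Rees chart `D₊(x̄₂t)` of `Bl_𝔪 X` is CM at every prime** (`2 ≠ 0` in `k`). [folklore assembly] -/
theorem cmCl_reesChart_two (h2 : (2 : k) ≠ 0)
    (q : Ideal (HomogeneousLocalization.Away (reesGrading (Ideal.span (Set.range fun i : Fin 6 => Ideal.Quotient.mk (Ideal.span (Set.range F)) (X i))))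
      (reesT ((fun i : Fin 6 => Ideal.Quotient.mk (Ideal.span (Set.range F)) (X i)) 2) (Ideal.subset_span (Set.mem_range_self (2 : Fin 6)))))) [q.IsPrime] :
    CMCl (Localization.AtPrime q) :=
  TowerBedChartCM.cmCl_reesChart k F 2 _ _ _ rfl rfl (theta_P_two k F hF0 hF1) (theta_Q_two k F hF0 hF1) (no_square_G_two k h2) (no_cube_H_two k) (by simp [constantCoeff_X])
    (by simp [constantCoeff_X]) 0 rfl q

/-! ## §3 Chart `x₃` -/

set_option linter.unusedSimpArgs false in
-- one `simp only` set serves all chart identities of this file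
/-- `θ₃P = y₃²·(y₀² − ιG₃)`. [folklore] -/
theorem theta_P_three : aeval (fun i : Fin 6 => if i = 3 then (X 3 : MvPolynomial (Fin 6) k) else X i * X 3) (C 2 * F 0 - F 1) =
    X 3 ^ 2 * ((![(X 0 : MvPolynomial (Fin 6) k) ^ 2 - MvPolynomial.eval₂Hom MvPolynomial.C ![MvPolynomial.X 2, MvPolynomial.X 3, MvPolynomial.X 4, MvPolynomial.X 5]
      (X 0 ^ 10 * X 1 ^ 8 - C 2 * (X 0 ^ 5 * X 1 ^ 3) + X 2 ^ 14 * X 1 ^ 12 - C 2 * (X 2 ^ 7 * X 1 ^ 5) + X 3 ^ 14 * X 1 ^ 12 - C 2 * (X 3 ^ 7 * X 1 ^ 5) + X 1 ^ 8 - C 2 * X 1 ^ 3 : MvPolynomial (Fin 4) k),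
      (X 1 : MvPolynomial (Fin 6) k) ^ 3 + MvPolynomial.eval₂Hom MvPolynomial.C ![MvPolynomial.X 2, MvPolynomial.X 3, MvPolynomial.X 4, MvPolynomial.X 5]
      (X 0 ^ 10 * X 1 ^ 7 - X 0 ^ 5 * X 1 ^ 2 + X 2 ^ 14 * X 1 ^ 11 - X 2 ^ 7 * X 1 ^ 4 + X 3 ^ 14 * X 1 ^ 11 - X 3 ^ 7 * X 1 ^ 4 + X 1 ^ 7 - X 1 ^ 2 : MvPolynomial (Fin 4) k)] : Fin 2 → MvPolynomial (Fin 6) k) 0) := by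
  rw [hF0, hF1]
  simp only [Matrix.cons_val_zero, map_sub, map_add, map_mul, map_pow, aeval_X, aeval_C, algebraMap_eq, Fin.reduceEq, if_true, if_false, map_ofNat, reduceIte,
    MvPolynomial.eval₂Hom_X', MvPolynomial.eval₂Hom_C, Matrix.cons_val_one, Matrix.cons_val]
  ring

set_option linter.unusedSimpArgs false in
-- one `simp only` set serves all chart identities of this file
/-- `θ₃Q = y₃³·(y₁³ + ιH₃)`. [folklore] -/
theorem theta_Q_three : aeval (fun i : Fin 6 => if i = 3 then (X 3 : MvPolynomial (Fin 6) k) else X i * X 3) (F 1 - F 0) =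
    X 3 ^ 3 * ((![(X 0 : MvPolynomial (Fin 6) k) ^ 2 - MvPolynomial.eval₂Hom MvPolynomial.C ![MvPolynomial.X 2, MvPolynomial.X 3, MvPolynomial.X 4, MvPolynomial.X 5]
      (X 0 ^ 10 * X 1 ^ 8 - C 2 * (X 0 ^ 5 * X 1 ^ 3) + X 2 ^ 14 * X 1 ^ 12 - C 2 * (X 2 ^ 7 * X 1 ^ 5) + X 3 ^ 14 * X 1 ^ 12 - C 2 * (X 3 ^ 7 * X 1 ^ 5) + X 1 ^ 8 - C 2 * X 1 ^ 3 : MvPolynomial (Fin 4) k),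
      (X 1 : MvPolynomial (Fin 6) k) ^ 3 + MvPolynomial.eval₂Hom MvPolynomial.C ![MvPolynomial.X 2, MvPolynomial.X 3, MvPolynomial.X 4, MvPolynomial.X 5]
      (X 0 ^ 10 * X 1 ^ 7 - X 0 ^ 5 * X 1 ^ 2 + X 2 ^ 14 * X 1 ^ 11 - X 2 ^ 7 * X 1 ^ 4 + X 3 ^ 14 * X 1 ^ 11 - X 3 ^ 7 * X 1 ^ 4 + X 1 ^ 7 - X 1 ^ 2 : MvPolynomial (Fin 4) k)] : Fin 2 → MvPolynomial (Fin 6) k) 1) := by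
  rw [hF0, hF1]
  simp only [Matrix.cons_val_zero, map_sub, map_add, map_mul, map_pow, aeval_X, aeval_C, algebraMap_eq, Fin.reduceEq, if_true, if_false, map_ofNat, reduceIte,
    MvPolynomial.eval₂Hom_X', MvPolynomial.eval₂Hom_C, Matrix.cons_val_one, Matrix.cons_val]
  ring

omit hF0 hF1 in
set_option linter.unusedSimpArgs false in
-- shared `simp only` set for the specialisations
/-- `G₃` is not a square (`2 ≠ 0`; `y₃ ↦ t` gives `(t⁵ − 2)·t³`). [elementary] -/
theorem no_square_G_three (h2 : (2 : k) ≠ 0) (y : MvPolynomial (Fin 4) k) : y ^ 2 ≠ (X 0 ^ 10 * X 1 ^ 8 - C 2 * (X 0 ^ 5 * X 1 ^ 3) + X 2 ^ 14 * X 1 ^ 12 - C 2 * (X 2 ^ 7 * X 1 ^ 5) + X 3 ^ 14 * X 1 ^ 12 - C 2 * (X 3 ^ 7 * X 1 ^ 5) + X 1 ^ 8 - C 2 * X 1 ^ 3 : MvPolynomial (Fin 4) k) := by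
  refine no_square_of_spec_shape k h2 _ (MvPolynomial.eval₂Hom (Polynomial.C : k →+* Polynomial k) (![0, Polynomial.X, 0, 0] : Fin 4 → Polynomial k)) 5 3 (by norm_num)
    (by norm_num) ?_ y
  simp only [map_add, map_sub, map_mul, map_pow, MvPolynomial.eval₂Hom_X', MvPolynomial.eval₂Hom_C, Matrix.cons_val_zero, Matrix.cons_val_one, Matrix.cons_val]
  ring

omit hF0 hF1 in
set_option linter.unusedSimpArgs false in
-- shared `simp only` set for the specialisations
/-- `−H₃` is not a cube (`y₃ ↦ t` gives `t⁷ − t²`). [elementary] -/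
theorem no_cube_H_three (y : MvPolynomial (Fin 4) k) : y ^ 3 + (X 0 ^ 10 * X 1 ^ 7 - X 0 ^ 5 * X 1 ^ 2 + X 2 ^ 14 * X 1 ^ 11 - X 2 ^ 7 * X 1 ^ 4 + X 3 ^ 14 * X 1 ^ 11 - X 3 ^ 7 * X 1 ^ 4 + X 1 ^ 7 - X 1 ^ 2 : MvPolynomial (Fin 4) k) ≠ 0 := by
  refine no_cube_of_spec_shape k _ (MvPolynomial.eval₂Hom (Polynomial.C : k →+* Polynomial k) (![0, Polynomial.X, 0, 0] : Fin 4 → Polynomial k)) 7 2 (by norm_num)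
    (by norm_num) ?_ y
  simp only [map_add, map_sub, map_mul, map_pow, MvPolynomial.eval₂Hom_X', MvPolynomial.eval₂Hom_C, Matrix.cons_val_zero, Matrix.cons_val_one, Matrix.cons_val]
  ring

/-- ★ **The Rees chart `D₊(x̄₃t)` of `Bl_𝔪 X` is CM at every prime** (`2 ≠ 0` in `k`). [folklore assembly] -/
theorem cmCl_reesChart_three (h2 : (2 : k) ≠ 0)
    (q : Ideal (HomogeneousLocalization.Away (reesGrading (Ideal.span (Set.range fun i : Fin 6 => Ideal.Quotient.mk (Ideal.span (Set.range F)) (X i))))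
      (reesT ((fun i : Fin 6 => Ideal.Quotient.mk (Ideal.span (Set.range F)) (X i)) 3) (Ideal.subset_span (Set.mem_range_self (3 : Fin 6)))))) [q.IsPrime] :
    CMCl (Localization.AtPrime q) :=
  TowerBedChartCM.cmCl_reesChart k F 3 _ _ _ rfl rfl (theta_P_three k F hF0 hF1) (theta_Q_three k F hF0 hF1) (no_square_G_three k h2) (no_cube_H_three k) (by simp [constantCoeff_X])
    (by simp [constantCoeff_X]) 1 rfl q

/-! ## §4 Chart `x₄` -/

set_option linter.unusedSimpArgs false in
-- one `simp only` set serves all chart identities of this file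
/-- `θ₄P = y₄²·(y₀² − ιG₄)`. [folklore] -/
theorem theta_P_four : aeval (fun i : Fin 6 => if i = 4 then (X 4 : MvPolynomial (Fin 6) k) else X i * X 4) (C 2 * F 0 - F 1) =
    X 4 ^ 2 * ((![(X 0 : MvPolynomial (Fin 6) k) ^ 2 - MvPolynomial.eval₂Hom MvPolynomial.C ![MvPolynomial.X 2, MvPolynomial.X 3, MvPolynomial.X 4, MvPolynomial.X 5]
      (X 0 ^ 10 * X 2 ^ 8 - C 2 * (X 0 ^ 5 * X 2 ^ 3) + X 1 ^ 10 * X 2 ^ 8 - C 2 * (X 1 ^ 5 * X 2 ^ 3) + X 3 ^ 14 * X 2 ^ 12 - C 2 * (X 3 ^ 7 * X 2 ^ 5) + X 2 ^ 12 - C 2 * X 2 ^ 5 : MvPolynomial (Fin 4) k),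
      (X 1 : MvPolynomial (Fin 6) k) ^ 3 + MvPolynomial.eval₂Hom MvPolynomial.C ![MvPolynomial.X 2, MvPolynomial.X 3, MvPolynomial.X 4, MvPolynomial.X 5]
      (X 0 ^ 10 * X 2 ^ 7 - X 0 ^ 5 * X 2 ^ 2 + X 1 ^ 10 * X 2 ^ 7 - X 1 ^ 5 * X 2 ^ 2 + X 3 ^ 14 * X 2 ^ 11 - X 3 ^ 7 * X 2 ^ 4 + X 2 ^ 11 - X 2 ^ 4 : MvPolynomial (Fin 4) k)] : Fin 2 → MvPolynomial (Fin 6) k) 0) := by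
  rw [hF0, hF1]
  simp only [Matrix.cons_val_zero, map_sub, map_add, map_mul, map_pow, aeval_X, aeval_C, algebraMap_eq, Fin.reduceEq, if_true, if_false, map_ofNat, reduceIte,
    MvPolynomial.eval₂Hom_X', MvPolynomial.eval₂Hom_C, Matrix.cons_val_one, Matrix.cons_val]
  ring

set_option linter.unusedSimpArgs false in
-- one `simp only` set serves all chart identities of this file
/-- `θ₄Q = y₄³·(y₁³ + ιH₄)`. [folklore] -/
theorem theta_Q_four : aeval (fun i : Fin 6 => if i = 4 then (X 4 : MvPolynomial (Fin 6) k) else X i * X 4) (F 1 - F 0) =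
    X 4 ^ 3 * ((![(X 0 : MvPolynomial (Fin 6) k) ^ 2 - MvPolynomial.eval₂Hom MvPolynomial.C ![MvPolynomial.X 2, MvPolynomial.X 3, MvPolynomial.X 4, MvPolynomial.X 5]
      (X 0 ^ 10 * X 2 ^ 8 - C 2 * (X 0 ^ 5 * X 2 ^ 3) + X 1 ^ 10 * X 2 ^ 8 - C 2 * (X 1 ^ 5 * X 2 ^ 3) + X 3 ^ 14 * X 2 ^ 12 - C 2 * (X 3 ^ 7 * X 2 ^ 5) + X 2 ^ 12 - C 2 * X 2 ^ 5 : MvPolynomial (Fin 4) k),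
      (X 1 : MvPolynomial (Fin 6) k) ^ 3 + MvPolynomial.eval₂Hom MvPolynomial.C ![MvPolynomial.X 2, MvPolynomial.X 3, MvPolynomial.X 4, MvPolynomial.X 5]
      (X 0 ^ 10 * X 2 ^ 7 - X 0 ^ 5 * X 2 ^ 2 + X 1 ^ 10 * X 2 ^ 7 - X 1 ^ 5 * X 2 ^ 2 + X 3 ^ 14 * X 2 ^ 11 - X 3 ^ 7 * X 2 ^ 4 + X 2 ^ 11 - X 2 ^ 4 : MvPolynomial (Fin 4) k)] : Fin 2 → MvPolynomial (Fin 6) k) 1) := by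
  rw [hF0, hF1]
  simp only [Matrix.cons_val_zero, map_sub, map_add, map_mul, map_pow, aeval_X, aeval_C, algebraMap_eq, Fin.reduceEq, if_true, if_false, map_ofNat, reduceIte,
    MvPolynomial.eval₂Hom_X', MvPolynomial.eval₂Hom_C, Matrix.cons_val_one, Matrix.cons_val]
  ring

omit hF0 hF1 in
set_option linter.unusedSimpArgs false in
-- shared `simp only` set for the specialisations
/-- `G₄` is not a square (`2 ≠ 0`; `y₄ ↦ t` gives `(t⁷ − 2)·t⁵`). [elementary] -/
theorem no_square_G_four (h2 : (2 : k) ≠ 0) (y : MvPolynomial (Fin 4) k) : y ^ 2 ≠ (X 0 ^ 10 * X 2 ^ 8 - C 2 * (X 0 ^ 5 * X 2 ^ 3) + X 1 ^ 10 * X 2 ^ 8 - C 2 * (X 1 ^ 5 * X 2 ^ 3) + X 3 ^ 14 * X 2 ^ 12 - C 2 * (X 3 ^ 7 * X 2 ^ 5) + X 2 ^ 12 - C 2 * X 2 ^ 5 : MvPolynomial (Fin 4) k) := by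
  refine no_square_of_spec_shape k h2 _ (MvPolynomial.eval₂Hom (Polynomial.C : k →+* Polynomial k) (![0, 0, Polynomial.X, 0] : Fin 4 → Polynomial k)) 7 5 (by norm_num)
    (by norm_num) ?_ y
  simp only [map_add, map_sub, map_mul, map_pow, MvPolynomial.eval₂Hom_X', MvPolynomial.eval₂Hom_C, Matrix.cons_val_zero, Matrix.cons_val_one, Matrix.cons_val]
  ring

omit hF0 hF1 in
set_option linter.unusedSimpArgs false in
-- shared `simp only` set for the specialisations
/-- `−H₄` is not a cube (`y₄ ↦ t` gives `t¹¹ − t⁴`). [elementary] -/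
theorem no_cube_H_four (y : MvPolynomial (Fin 4) k) : y ^ 3 + (X 0 ^ 10 * X 2 ^ 7 - X 0 ^ 5 * X 2 ^ 2 + X 1 ^ 10 * X 2 ^ 7 - X 1 ^ 5 * X 2 ^ 2 + X 3 ^ 14 * X 2 ^ 11 - X 3 ^ 7 * X 2 ^ 4 + X 2 ^ 11 - X 2 ^ 4 : MvPolynomial (Fin 4) k) ≠ 0 := by
  refine no_cube_of_spec_shape k _ (MvPolynomial.eval₂Hom (Polynomial.C : k →+* Polynomial k) (![0, 0, Polynomial.X, 0] : Fin 4 → Polynomial k)) 11 4 (by norm_num)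
    (by norm_num) ?_ y
  simp only [map_add, map_sub, map_mul, map_pow, MvPolynomial.eval₂Hom_X', MvPolynomial.eval₂Hom_C, Matrix.cons_val_zero, Matrix.cons_val_one, Matrix.cons_val]
  ring

/-- ★ **The Rees chart `D₊(x̄₄t)` of `Bl_𝔪 X` is CM at every prime** (`2 ≠ 0` in `k`). [folklore assembly] -/
theorem cmCl_reesChart_four (h2 : (2 : k) ≠ 0)
    (q : Ideal (HomogeneousLocalization.Away (reesGrading (Ideal.span (Set.range fun i : Fin 6 => Ideal.Quotient.mk (Ideal.span (Set.range F)) (X i))))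
      (reesT ((fun i : Fin 6 => Ideal.Quotient.mk (Ideal.span (Set.range F)) (X i)) 4) (Ideal.subset_span (Set.mem_range_self (4 : Fin 6)))))) [q.IsPrime] :
    CMCl (Localization.AtPrime q) :=
  TowerBedChartCM.cmCl_reesChart k F 4 _ _ _ rfl rfl (theta_P_four k F hF0 hF1) (theta_Q_four k F hF0 hF1) (no_square_G_four k h2) (no_cube_H_four k) (by simp [constantCoeff_X])
    (by simp [constantCoeff_X]) 2 rfl q

/-! ## §5 Chart `x₅` -/

set_option linter.unusedSimpArgs false in
-- one `simp only` set serves all chart identities of this file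
/-- `θ₅P = y₅²·(y₀² − ιG₅)`. [folklore] -/
theorem theta_P_five : aeval (fun i : Fin 6 => if i = 5 then (X 5 : MvPolynomial (Fin 6) k) else X i * X 5) (C 2 * F 0 - F 1) =
    X 5 ^ 2 * ((![(X 0 : MvPolynomial (Fin 6) k) ^ 2 - MvPolynomial.eval₂Hom MvPolynomial.C ![MvPolynomial.X 2, MvPolynomial.X 3, MvPolynomial.X 4, MvPolynomial.X 5]
      (X 0 ^ 10 * X 3 ^ 8 - C 2 * (X 0 ^ 5 * X 3 ^ 3) + X 1 ^ 10 * X 3 ^ 8 - C 2 * (X 1 ^ 5 * X 3 ^ 3) + X 2 ^ 14 * X 3 ^ 12 - C 2 * (X 2 ^ 7 * X 3 ^ 5) + X 3 ^ 12 - C 2 * X 3 ^ 5 : MvPolynomial (Fin 4) k),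
      (X 1 : MvPolynomial (Fin 6) k) ^ 3 + MvPolynomial.eval₂Hom MvPolynomial.C ![MvPolynomial.X 2, MvPolynomial.X 3, MvPolynomial.X 4, MvPolynomial.X 5]
      (X 0 ^ 10 * X 3 ^ 7 - X 0 ^ 5 * X 3 ^ 2 + X 1 ^ 10 * X 3 ^ 7 - X 1 ^ 5 * X 3 ^ 2 + X 2 ^ 14 * X 3 ^ 11 - X 2 ^ 7 * X 3 ^ 4 + X 3 ^ 11 - X 3 ^ 4 : MvPolynomial (Fin 4) k)] : Fin 2 → MvPolynomial (Fin 6) k) 0) := by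
  rw [hF0, hF1]
  simp only [Matrix.cons_val_zero, map_sub, map_add, map_mul, map_pow, aeval_X, aeval_C, algebraMap_eq, Fin.reduceEq, if_true, if_false, map_ofNat, reduceIte,
    MvPolynomial.eval₂Hom_X', MvPolynomial.eval₂Hom_C, Matrix.cons_val_one, Matrix.cons_val]
  ring

set_option linter.unusedSimpArgs false in
-- one `simp only` set serves all chart identities of this file
/-- `θ₅Q = y₅³·(y₁³ + ιH₅)`. [folklore] -/
theorem theta_Q_five : aeval (fun i : Fin 6 => if i = 5 then (X 5 : MvPolynomial (Fin 6) k) else X i * X 5) (F 1 - F 0) =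
    X 5 ^ 3 * ((![(X 0 : MvPolynomial (Fin 6) k) ^ 2 - MvPolynomial.eval₂Hom MvPolynomial.C ![MvPolynomial.X 2, MvPolynomial.X 3, MvPolynomial.X 4, MvPolynomial.X 5]
      (X 0 ^ 10 * X 3 ^ 8 - C 2 * (X 0 ^ 5 * X 3 ^ 3) + X 1 ^ 10 * X 3 ^ 8 - C 2 * (X 1 ^ 5 * X 3 ^ 3) + X 2 ^ 14 * X 3 ^ 12 - C 2 * (X 2 ^ 7 * X 3 ^ 5) + X 3 ^ 12 - C 2 * X 3 ^ 5 : MvPolynomial (Fin 4) k),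
      (X 1 : MvPolynomial (Fin 6) k) ^ 3 + MvPolynomial.eval₂Hom MvPolynomial.C ![MvPolynomial.X 2, MvPolynomial.X 3, MvPolynomial.X 4, MvPolynomial.X 5]
      (X 0 ^ 10 * X 3 ^ 7 - X 0 ^ 5 * X 3 ^ 2 + X 1 ^ 10 * X 3 ^ 7 - X 1 ^ 5 * X 3 ^ 2 + X 2 ^ 14 * X 3 ^ 11 - X 2 ^ 7 * X 3 ^ 4 + X 3 ^ 11 - X 3 ^ 4 : MvPolynomial (Fin 4) k)] : Fin 2 → MvPolynomial (Fin 6) k) 1) := by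
  rw [hF0, hF1]
  simp only [Matrix.cons_val_zero, map_sub, map_add, map_mul, map_pow, aeval_X, aeval_C, algebraMap_eq, Fin.reduceEq, if_true, if_false, map_ofNat, reduceIte,
    MvPolynomial.eval₂Hom_X', MvPolynomial.eval₂Hom_C, Matrix.cons_val_one, Matrix.cons_val]
  ring

/-- ★ **The Rees chart `D₊(x̄₅t)` of `Bl_𝔪 X` is CM at every prime** (`2 ≠ 0` in `k`). [folklore assembly] -/
theorem cmCl_reesChart_five (h2 : (2 : k) ≠ 0)
    (q : Ideal (HomogeneousLocalization.Away (reesGrading (Ideal.span (Set.range fun i : Fin 6 => Ideal.Quotient.mk (Ideal.span (Set.range F)) (X i))))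
      (reesT ((fun i : Fin 6 => Ideal.Quotient.mk (Ideal.span (Set.range F)) (X i)) 5) (Ideal.subset_span (Set.mem_range_self (5 : Fin 6)))))) [q.IsPrime] :
    CMCl (Localization.AtPrime q) :=
  TowerBedChartCM.cmCl_reesChart k F 5 _ _ _ rfl rfl (theta_P_five k F hF0 hF1) (theta_Q_five k F hF0 hF1) (TwoRatioBPChart5NotFull.no_square_G₅ k h2) (TwoRatioBPChart5NotFull.no_cube_H₅ k) (by simp [constantCoeff_X])
    (by simp [constantCoeff_X]) 3 rfl q

end Bed

end Summit.ResolutionOfSingularities.ResolutionOfSingularities.Theorems.FInjectiveMacaulayfication.TwoRatioBPChartsCM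

end
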